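import Literature.Barriers.PneNP.TSPExtensionComplexityHubGadget
import Literature.Barriers.PneNP.TSPExtensionComplexityGadgetTours
import HarnessLib

/-!
# The hub gadget: every perfect matching is the trace of a tour

Support file for the discharge of `Literature.Barriers.PneNP.Rothvoss2017_tsp`, continuing
`…HubGadget.lean`. Given a fixed-point-free involution `mate` of `Fin n` (a perfect matching of
`K_n`, `n = 2h`), we list the vertices of `HV n h s` block by block — block `l` is
`hub l, w r, [pad (s-1), …, pad 0 if r = 0], v r, v (mate r), w (mate r)` for the `l`-th
representative `r` (`r < mate r`) — and close up. Block junctions are companion–hub pairs,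
which are always edges of the gadget, so the cyclic sequence is a Hamiltonian cycle of the
gadget (`HubTour.isTourOn_mateTour`, `HubTour.mateTour_subset`), and its `v–v` edges are
exactly the pairs `{v i, v (mate i)}` (`HubTour.vv_mem_mateTour_iff`, using the uniqueness half
from `…HubGadget.lean`); packaged as `exists_tour_of_mate`. Generic list helpers
(`head_flatten_mem`, `getLast_flatten_mem`, `mem_cycEdges_append`, `isTourOn_cycEdges`) come
from the FMPTW gadget files (whose own `blk`/`owner` live in the enclosing namespace, hence the
namespace `HubTour` here). All [folklore].
-/

namespace Literature.Barriers.PneNP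

open HV Finset

namespace HubTour

variable {n h s : ℕ} (mate : Fin n → Fin n)

/-! ### Representatives of the matched pairs -/

/-- Representatives: the smaller element of each matched pair. [folklore] -/
def reps : Finset (Fin n) := univ.filter fun i => i < mate i

/-- Every vertex or its partner is a representative. [folklore] -/
theorem mem_reps_or (hmm : ∀ i, mate (mate i) = i) (hmi : ∀ i, mate i ≠ i) (i : Fin n) :
    i ∈ reps mate ∨ mate i ∈ reps mate := by
  simp only [reps, mem_filter, mem_univ, true_and, hmm]
  rcases lt_or_gt_of_ne (hmi i) with hlt | hgt
  · exact Or.inr hlt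
  · exact Or.inl hgt

/-- A partner of a representative is not a representative. [folklore] -/
theorem mate_not_mem_reps (hmm : ∀ i, mate (mate i) = i) {i : Fin n} (hi : i ∈ reps mate) :
    mate i ∉ reps mate := by
  simp only [reps, mem_filter, mem_univ, true_and, hmm] at hi ⊢
  exact not_lt.2 hi.le

/-- There are exactly `n / 2` representatives. [folklore] -/
theorem two_mul_card_reps (hmm : ∀ i, mate (mate i) = i) (hmi : ∀ i, mate i ≠ i) :
    2 * (reps mate).card = n := by
  have hunion : reps mate ∪ (reps mate).image mate = univ := by
    ext i
    simp only [mem_union, mem_image, mem_univ, iff_true]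
    rcases mem_reps_or mate hmm hmi i with hi | hi
    · exact Or.inl hi
    · exact Or.inr ⟨mate i, hi, hmm i⟩
  have hdisj : Disjoint (reps mate) ((reps mate).image mate) := by
    rw [disjoint_left]
    rintro i hi hi'
    obtain ⟨j, hj, rfl⟩ := mem_image.1 hi'
    exact mate_not_mem_reps mate hmm hj hi
  have hinj : Function.Injective mate := fun a b hab => by rw [← hmm a, hab, hmm]
  have := congrArg Finset.card hunion
  rw [card_union_of_disjoint hdisj, card_image_of_injective _ hinj, card_univ,
    Fintype.card_fin] at this
  omega

/-- The representative of `i`'s pair. [folklore] -/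
def repOf (i : Fin n) : Fin n := if i < mate i then i else mate i

/-- `repOf i` is a representative. [folklore] -/
theorem repOf_mem (hmm : ∀ i, mate (mate i) = i) (hmi : ∀ i, mate i ≠ i) (i : Fin n) :
    repOf mate i ∈ reps mate := by
  unfold repOf
  split_ifs with hi
  · simpa [reps] using hi
  · rcases mem_reps_or mate hmm hmi i with h' | h'
    · exact absurd (by simpa [reps] using h') hi
    · exact h'

/-- `repOf` of a representative. [folklore] -/
theorem repOf_of_mem {i : Fin n} (hi : i ∈ reps mate) : repOf mate i = i := by
  unfold repOf
  simp only [reps, mem_filter, mem_univ, true_and] at hi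
  simp [hi]

/-- `repOf` of the partner of a representative. [folklore] -/
theorem repOf_mate_of_mem (hmm : ∀ i, mate (mate i) = i) {i : Fin n} (hi : i ∈ reps mate) :
    repOf mate (mate i) = i := by
  have h1 : ¬mate i < mate (mate i) := by
    have := mate_not_mem_reps mate hmm hi
    simpa [reps] using this
  rw [hmm] at h1
  unfold repOf
  rw [hmm, if_neg h1]

/-- `repOf i` is `i` or its partner. [folklore] -/
theorem repOf_eq_or (i : Fin n) : repOf mate i = i ∨ repOf mate i = mate i := by
  unfold repOf
  split_ifs
  · exact Or.inl rfl
  · exact Or.inr rfl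

/-- `|reps| = h` when `2h = n`. [folklore] -/
theorem card_reps_eq (hmm : ∀ i, mate (mate i) = i) (hmi : ∀ i, mate i ≠ i) (hhn : 2 * h = n) :
    (reps mate).card = h := by
  have := two_mul_card_reps mate hmm hmi
  omega

/-- Enumeration of the representatives by the hubs. [folklore] -/
noncomputable def repEquiv (hR : (reps mate).card = h) : {x // x ∈ reps mate} ≃ Fin h :=
  (reps mate).equivFin.trans (finCongr hR)

/-- The representative served by hub `l`. [folklore] -/
noncomputable def rep (hR : (reps mate).card = h) (l : Fin h) : Fin n :=
  ((repEquiv mate hR).symm l : Fin n)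

/-- The hub serving vertex `i`. [folklore] -/
noncomputable def hubOf (hR : (reps mate).card = h) (hmm : ∀ i, mate (mate i) = i)
    (hmi : ∀ i, mate i ≠ i) (i : Fin n) : Fin h :=
  repEquiv mate hR ⟨repOf mate i, repOf_mem mate hmm hmi i⟩

/-- `rep l` is a representative. [folklore] -/
theorem rep_mem (hR : (reps mate).card = h) (l : Fin h) : rep mate hR l ∈ reps mate :=
  ((repEquiv mate hR).symm l).2

/-- `hubOf (rep l) = l`. [folklore] -/
theorem hubOf_rep (hR : (reps mate).card = h) (hmm : ∀ i, mate (mate i) = i) (hmi : ∀ i, mate i ≠ i)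
    (l : Fin h) : hubOf mate hR hmm hmi (rep mate hR l) = l := by
  unfold hubOf rep
  have : (⟨repOf mate ((repEquiv mate hR).symm l : Fin n), repOf_mem mate hmm hmi _⟩ :
      {x // x ∈ reps mate}) = (repEquiv mate hR).symm l := by
    apply Subtype.ext
    exact repOf_of_mem mate ((repEquiv mate hR).symm l).2
  rw [this, Equiv.apply_symm_apply]

/-- `rep (hubOf i) = repOf i`. [folklore] -/
theorem rep_hubOf (hR : (reps mate).card = h) (hmm : ∀ i, mate (mate i) = i) (hmi : ∀ i, mate i ≠ i)
    (i : Fin n) : rep mate hR (hubOf mate hR hmm hmi i) = repOf mate i := by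
  unfold hubOf rep
  rw [Equiv.symm_apply_apply]

/-- `hubOf (mate (rep l)) = l`. [folklore] -/
theorem hubOf_mate_rep (hR : (reps mate).card = h) (hmm : ∀ i, mate (mate i) = i)
    (hmi : ∀ i, mate i ≠ i) (l : Fin h) : hubOf mate hR hmm hmi (mate (rep mate hR l)) = l := by
  unfold hubOf
  have : (⟨repOf mate (mate (rep mate hR l)), repOf_mem mate hmm hmi _⟩ : {x // x ∈ reps mate}) =
      (repEquiv mate hR).symm l := by
    apply Subtype.ext
    exact repOf_mate_of_mem mate hmm ((repEquiv mate hR).symm l).2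
  rw [this, Equiv.apply_symm_apply]

/-- `0` is a representative (`n ≥ 1`). [folklore] -/
theorem zero_mem_reps (hmi : ∀ i, mate i ≠ i) (hn : 0 < n) : (⟨0, hn⟩ : Fin n) ∈ reps mate := by
  simp only [reps, mem_filter, mem_univ, true_and]
  rcases lt_or_gt_of_ne (hmi ⟨0, hn⟩) with hlt | hgt
  · exact absurd (Fin.lt_def.1 hlt) (Nat.not_lt_zero _)
  · exact hgt

/-! ### The chain of pads -/

/-- The pads from the top of the chain down: `pad (j-1), …, pad 0`. [folklore] -/
def padsFrom : (j : ℕ) → j ≤ s → List (HV n h s)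
  | 0, _ => []
  | j + 1, hj => pad ⟨j, hj⟩ :: padsFrom j (Nat.le_of_succ_le hj)

/-- Membership in `padsFrom`. [folklore] -/
theorem mem_padsFrom_iff : ∀ (j : ℕ) (hj : j ≤ s) (x : HV n h s),
    x ∈ padsFrom j hj ↔ ∃ j' : Fin s, (j' : ℕ) < j ∧ x = pad j'
  | 0, _, x => by simp [padsFrom]
  | j + 1, hj, x => by
    rw [padsFrom, List.mem_cons, mem_padsFrom_iff j (Nat.le_of_succ_le hj) x]
    constructor
    · rintro (rfl | ⟨j', hj', rfl⟩)
      · exact ⟨⟨j, hj⟩, Nat.lt_succ_self j, rfl⟩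
      · exact ⟨j', Nat.lt_succ_of_lt hj', rfl⟩
    · rintro ⟨j', hj', rfl⟩
      by_cases h' : (j' : ℕ) = j
      · left
        congr 1
        exact Fin.ext h'
      · exact Or.inr ⟨j', by omega, rfl⟩

/-- `padsFrom` has no repetition. [folklore] -/
theorem nodup_padsFrom : ∀ (j : ℕ) (hj : j ≤ s), (padsFrom j hj : List (HV n h s)).Nodup
  | 0, _ => List.nodup_nil
  | j + 1, hj => by
    rw [padsFrom, List.nodup_cons, mem_padsFrom_iff]
    refine ⟨?_, nodup_padsFrom j _⟩
    rintro ⟨j', hj', h'⟩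
    simp only [HV.pad.injEq] at h'
    subst h'
    simp at hj'

/-- The chain below position `j` followed by `v 0` and a tail is a path of the gadget,
provided the tail continues from `v 0`; its first vertex has chain position `j`. [folklore] -/
theorem isChain_padsFrom (hn : 0 < n) (rest : List (HV n h s))
    (hrest : List.IsChain (hubGadget n h s).Adj (v ⟨0, hn⟩ :: rest)) :
    ∀ (j : ℕ) (hj : j ≤ s), List.IsChain (hubGadget n h s).Adj (padsFrom j hj ++ v ⟨0, hn⟩ :: rest) ∧
      ∃ y ys, padsFrom j hj ++ v ⟨0, hn⟩ :: rest = y :: ys ∧ cpos y = some j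
  | 0, _ => ⟨by simpa [padsFrom] using hrest, v ⟨0, hn⟩, rest, by simp [padsFrom], by simp [cpos]⟩
  | j + 1, hj => by
    obtain ⟨hc, y, ys, hy, hcpos⟩ := isChain_padsFrom hn rest hrest j (Nat.le_of_succ_le hj)
    refine ⟨?_, pad ⟨j, hj⟩, padsFrom j (Nat.le_of_succ_le hj) ++ v ⟨0, hn⟩ :: rest,
      by rw [padsFrom, List.cons_append], by simp [cpos]⟩
    rw [padsFrom, List.cons_append, hy, List.isChain_cons_cons]
    refine ⟨?_, hy ▸ hc⟩
    refine (adj_of_cpos ?_ hcpos (by simp [cpos])).symm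
    rintro rfl
    simp [cpos] at hcpos

/-! ### Blocks -/

/-- Block `l`: `hub l, w r, [chain down if r = 0], v r, v (mate r), w (mate r)` for
`r = rep l`. [folklore] -/
noncomputable def blk (hR : (reps mate).card = h) (l : Fin h) : List (HV n h s) :=
  hub l :: w (rep mate hR l) ::
    ((if ((rep mate hR l : Fin n) : ℕ) = 0 then padsFrom s le_rfl else []) ++
      [v (rep mate hR l), v (mate (rep mate hR l)), w (mate (rep mate hR l))])

/-- The block owning a vertex. [folklore] -/
noncomputable def owner (hR : (reps mate).card = h) (hmm : ∀ i, mate (mate i) = i)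
    (hmi : ∀ i, mate i ≠ i) (hn : 0 < n) : HV n h s → Fin h
  | hub l => l
  | v i => hubOf mate hR hmm hmi i
  | w i => hubOf mate hR hmm hmi i
  | pad _ => hubOf mate hR hmm hmi ⟨0, hn⟩

/-- A representative with value `0` is the vertex `0`. [folklore] -/
theorem rep_eq_zero_iff (hR : (reps mate).card = h) (hmm : ∀ i, mate (mate i) = i)
    (hmi : ∀ i, mate i ≠ i) (hn : 0 < n) (l : Fin h) :
    ((rep mate hR l : Fin n) : ℕ) = 0 ↔ l = hubOf mate hR hmm hmi ⟨0, hn⟩ := by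
  constructor
  · intro h0
    have : rep mate hR l = ⟨0, hn⟩ := Fin.ext h0
    rw [← hubOf_rep mate hR hmm hmi l, this]
  · rintro rfl
    rw [rep_hubOf, repOf_of_mem mate (zero_mem_reps mate hmi hn)]

/-- Pads never occur in the non-chain part of a block. [folklore] -/
theorem pad_not_mem_ite (hR : (reps mate).card = h) (l : Fin h) (j : Fin s)
    (h0 : ((rep mate hR l : Fin n) : ℕ) ≠ 0) :
    (pad j : HV n h s) ∉ ((if ((rep mate hR l : Fin n) : ℕ) = 0 then padsFrom s le_rfl else []) :
      List (HV n h s)) := by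
  rw [if_neg h0]; simp

/-- **Membership in a block is ownership.** [folklore] -/
theorem mem_blk_iff (hR : (reps mate).card = h) (hmm : ∀ i, mate (mate i) = i)
    (hmi : ∀ i, mate i ≠ i) (hn : 0 < n) (l : Fin h) (x : HV n h s) :
    x ∈ blk mate hR l ↔ owner mate hR hmm hmi hn x = l := by
  -- what the optional chain segment can contain
  have hseg : ∀ y : HV n h s, y ∈ ((if ((rep mate hR l : Fin n) : ℕ) = 0 then padsFrom s le_rfl
      else []) : List (HV n h s)) ↔ ((rep mate hR l : Fin n) : ℕ) = 0 ∧ ∃ j, y = pad j := by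
    intro y
    split_ifs with h0
    · rw [mem_padsFrom_iff]
      simp only [h0, true_and]
      constructor
      · rintro ⟨j, -, rfl⟩; exact ⟨j, rfl⟩
      · rintro ⟨j, rfl⟩; exact ⟨j, j.2, rfl⟩
    · simp [h0]
  simp only [blk, List.mem_cons, List.mem_append, hseg, List.not_mem_nil, or_false]
  rcases x with i | i | l' | j
  · -- originals
    simp only [owner, reduceCtorEq, HV.v.injEq, false_or, and_false, exists_false, or_false]
    constructor
    · rintro (rfl | rfl)
      · exact hubOf_rep mate hR hmm hmi l
      · exact hubOf_mate_rep mate hR hmm hmi l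
    · rintro rfl
      rcases repOf_eq_or mate i with h' | h'
      · exact Or.inl (by rw [rep_hubOf, h'])
      · right
        rw [rep_hubOf, h', hmm]
  · -- companions
    simp only [owner, reduceCtorEq, HV.w.injEq, false_or, and_false, exists_false]
    constructor
    · rintro (rfl | rfl)
      · exact hubOf_rep mate hR hmm hmi l
      · exact hubOf_mate_rep mate hR hmm hmi l
    · rintro rfl
      rcases repOf_eq_or mate i with h' | h'
      · exact Or.inl (by rw [rep_hubOf, h'])
      · right
        rw [rep_hubOf, h', hmm]
  · -- hubs
    simp only [owner, HV.hub.injEq, reduceCtorEq, and_false, exists_false, or_false]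
  · -- pads
    simp only [owner, reduceCtorEq, false_or, HV.pad.injEq, exists_eq', and_true, or_false]
    rw [rep_eq_zero_iff mate hR hmm hmi hn l, eq_comm]

/-- Blocks have no repetition. [folklore] -/
theorem nodup_blk (hR : (reps mate).card = h) (hmi : ∀ i, mate i ≠ i) (l : Fin h) :
    (blk mate hR l : List (HV n h s)).Nodup := by
  have hne : mate (rep mate hR l) ≠ rep mate hR l := hmi _
  have hseg : ∀ y : HV n h s, y ∈ ((if ((rep mate hR l : Fin n) : ℕ) = 0 then padsFrom s le_rfl
      else []) : List (HV n h s)) → ∃ j, y = pad j := by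
    intro y hy
    split_ifs at hy with h0
    · obtain ⟨j, -, rfl⟩ := (mem_padsFrom_iff _ _ _).1 hy
      exact ⟨j, rfl⟩
    · simp at hy
  have hne' : rep mate hR l ≠ mate (rep mate hR l) := fun h' => hne h'.symm
  unfold blk
  rw [List.nodup_cons, List.nodup_cons]
  refine ⟨?_, ?_, ?_⟩
  · simp only [List.mem_cons, List.mem_append, reduceCtorEq, false_or, List.not_mem_nil, or_false]
    intro hmem
    obtain ⟨j, hj⟩ := hseg _ hmem
    exact absurd hj (by simp)
  · simp only [List.mem_append, List.mem_cons, reduceCtorEq, HV.w.injEq, false_or, List.not_mem_nil,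
      or_false]
    rintro (hmem | h')
    · obtain ⟨j, hj⟩ := hseg _ hmem
      exact absurd hj (by simp)
    · exact hne h'.symm
  · rw [List.nodup_append]
    refine ⟨?_, ?_, ?_⟩
    · split_ifs
      · exact nodup_padsFrom _ _
      · exact List.nodup_nil
    · simp [hne']
    · intro x hx y hy
      obtain ⟨j, rfl⟩ := hseg _ hx
      simp only [List.mem_cons, List.not_mem_nil, or_false] at hy
      rcases hy with rfl | rfl | rfl <;> simp

/-- Blocks are paths of the gadget. [folklore] -/
theorem isChain_blk (hR : (reps mate).card = h) (hmm : ∀ i, mate (mate i) = i)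
    (hmi : ∀ i, mate i ≠ i) (hn : 0 < n) (l : Fin h) :
    List.IsChain (hubGadget n h s).Adj (blk mate hR l) := by
  have hr := rep_mem mate hR l
  have hmr0 : ((mate (rep mate hR l) : Fin n) : ℕ) ≠ 0 := by
    intro h0
    have : mate (rep mate hR l) = ⟨0, hn⟩ := Fin.ext h0
    exact mate_not_mem_reps mate hmm hr (this ▸ zero_mem_reps mate hmi hn)
  have htail : List.IsChain (hubGadget n h s).Adj
      [v (rep mate hR l), v (mate (rep mate hR l)), w (mate (rep mate hR l))] := by
    rw [List.isChain_cons_cons, List.isChain_cons_cons]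
    exact ⟨adj_v_v (hmi _).symm, adj_v_w hmr0, List.isChain_singleton _⟩
  unfold blk
  rw [List.isChain_cons]
  refine ⟨?_, ?_⟩
  · intro y hy
    rw [List.head?_cons, Option.mem_def, Option.some.injEq] at hy
    rw [← hy]
    exact adj_hub_w l _
  · split_ifs with h0
    · -- `r = 0`: `w 0`, then the chain down to `v 0`, then the tail
      have hr0 : rep mate hR l = ⟨0, hn⟩ := Fin.ext h0
      rw [hr0] at htail ⊢
      obtain ⟨hc, y, ys, hy, hcpos⟩ :=
        isChain_padsFrom hn [v (mate ⟨0, hn⟩), w (mate ⟨0, hn⟩)] htail s le_rfl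
      rw [hy, List.isChain_cons_cons]
      refine ⟨(adj_of_cpos ?_ hcpos (by simp [cpos])).symm, hy ▸ hc⟩
      rintro rfl
      simp [cpos] at hcpos
    · -- `r ≠ 0`: `w r – v r` directly
      rw [List.nil_append, List.isChain_cons_cons]
      exact ⟨(adj_v_w h0).symm, htail⟩

/-- Blocks start at their hub. [folklore] -/
theorem head?_blk (hR : (reps mate).card = h) (l : Fin h) :
    (blk mate hR l : List (HV n h s)).head? = some (hub l) := rfl

/-- The last vertex of a block is a companion. [folklore] -/
theorem getLast_blk (hR : (reps mate).card = h) (l : Fin h) (hne : (blk mate hR l : List (HV n h s)) ≠ []) :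
    ∃ i, (blk mate hR l).getLast hne = w i := by
  refine ⟨mate (rep mate hR l), ?_⟩
  unfold blk
  rw [List.getLast_cons, List.getLast_cons, List.getLast_append_of_ne_nil]
  · simp
  all_goals simp

/-! ### The tour -/

/-- The vertex sequence: all blocks, in the order of the hubs. [folklore] -/
noncomputable def tourSeq (hR : (reps mate).card = h) : List (HV n h s) :=
  (univ : Finset (Fin h)).toList.flatMap (blk mate hR)

section tour

variable (hR : (reps mate).card = h) (hmm : ∀ i, mate (mate i) = i) (hmi : ∀ i, mate i ≠ i)
  (hn : 0 < n)
include hmm hmi hn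

/-- Every vertex is listed. [folklore] -/
theorem mem_tourSeq (x : HV n h s) : x ∈ tourSeq mate hR :=
  List.mem_flatMap.2 ⟨owner mate hR hmm hmi hn x, mem_toList.2 (mem_univ _),
    (mem_blk_iff mate hR hmm hmi hn _ x).2 rfl⟩

/-- No vertex is listed twice. [folklore] -/
theorem nodup_tourSeq : (tourSeq mate hR : List (HV n h s)).Nodup := by
  rw [tourSeq, List.nodup_flatMap]
  refine ⟨fun l _ => nodup_blk mate hR hmi l, ?_⟩
  refine (nodup_toList _).pairwise_of_forall_ne fun l _ l' _ hll' => ?_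
  intro x hx hx'
  exact hll' (((mem_blk_iff mate hR hmm hmi hn l x).1 hx).symm.trans
    ((mem_blk_iff mate hR hmm hmi hn l' x).1 hx'))

/-- Its length is the number of vertices. [folklore] -/
theorem length_tourSeq : (tourSeq mate hR : List (HV n h s)).length = 2 * n + h + s := by
  rw [← HV.card, ← List.toFinset_card_of_nodup (nodup_tourSeq mate hR hmm hmi hn), ← card_univ]
  congr 1
  exact eq_univ_iff_forall.2 fun x => List.mem_toFinset.2 (mem_tourSeq mate hR hmm hmi hn x)

/-- [folklore] -/
theorem tourSeq_ne_nil : (tourSeq mate hR : List (HV n h s)) ≠ [] := by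
  intro h0
  have := length_tourSeq mate hR hmm hmi hn (s := s)
  rw [h0, List.length_nil] at this
  omega

/-- The sequence is a path of the gadget. [folklore] -/
theorem isChain_tourSeq : List.IsChain (hubGadget n h s).Adj (tourSeq mate hR) := by
  classical
  rw [tourSeq, List.flatMap_def, ← List.flatten_filter_ne_nil]
  rw [List.isChain_flatten (by simp)]
  refine ⟨fun b hb => ?_, ?_⟩
  · obtain ⟨hb, -⟩ := List.mem_filter.1 hb
    obtain ⟨l, -, rfl⟩ := List.mem_map.1 hb
    exact isChain_blk mate hR hmm hmi hn l
  · refine List.Pairwise.isChain (List.Pairwise.filter _ ?_)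
    rw [List.pairwise_map]
    refine (nodup_toList _).pairwise_of_forall_ne fun l _ l' _ _ => ?_
    intro x hx y hy
    have hne1 : (blk mate hR l : List (HV n h s)) ≠ [] := by rintro h'; simp [h'] at hx
    rw [List.getLast?_eq_some_getLast hne1] at hx
    rw [head?_blk] at hy
    simp only [Option.mem_def, Option.some.injEq] at hx hy
    subst hx; subst hy
    obtain ⟨i, hi⟩ := getLast_blk mate hR l hne1
    rw [hi]
    exact (adj_hub_w l' i).symm

/-- The sequence closes up through a companion–hub edge. [folklore] -/
theorem adj_getLast_head_tourSeq :
    (hubGadget n h s).Adj ((tourSeq mate hR).getLast (tourSeq_ne_nil mate hR hmm hmi hn))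
      ((tourSeq mate hR).head (tourSeq_ne_nil mate hR hmm hmi hn)) := by
  have h' : ((univ : Finset (Fin h)).toList.map (blk mate hR)).flatten ≠ ([] : List (HV n h s)) := by
    rw [← List.flatMap_def]; exact tourSeq_ne_nil mate hR hmm hmi hn
  -- the head is a hub
  obtain ⟨b, hb, hne, heq⟩ := head_flatten_mem _ h'
  obtain ⟨l, -, rfl⟩ := List.mem_map.1 hb
  have hhead : (tourSeq mate hR : List (HV n h s)).head (tourSeq_ne_nil mate hR hmm hmi hn) = hub l := by
    have : (tourSeq mate hR : List (HV n h s)).head (tourSeq_ne_nil mate hR hmm hmi hn) =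
        (blk mate hR l).head hne := by
      rw [← heq]; congr 1
    rw [this, List.head_eq_iff_head?_eq_some, head?_blk]
  -- the last vertex is a companion
  obtain ⟨b', hb', hne', heq'⟩ := getLast_flatten_mem _ h'
  obtain ⟨l', -, rfl⟩ := List.mem_map.1 hb'
  obtain ⟨i, hi⟩ := getLast_blk mate hR l' hne'
  have hlast : (tourSeq mate hR : List (HV n h s)).getLast (tourSeq_ne_nil mate hR hmm hmi hn) = w i := by
    have : (tourSeq mate hR : List (HV n h s)).getLast (tourSeq_ne_nil mate hR hmm hmi hn) =
        (blk mate hR l').getLast hne' := by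
      rw [← heq']; congr 1
    rw [this, hi]
  rw [hhead, hlast]
  exact (adj_hub_w l i).symm

end tour

/-- The tour of the gadget encoding `mate`. [folklore] -/
noncomputable def mateTour (hR : (reps mate).card = h) : Finset (Sym2 (HV n h s)) :=
  cycEdges (tourSeq mate hR)

/-- **It is a tour** (`n ≥ 1`, so at least `5` vertices). [folklore] -/
theorem isTourOn_mateTour (hR : (reps mate).card = h) (hmm : ∀ i, mate (mate i) = i)
    (hmi : ∀ i, mate i ≠ i) (hhn : 2 * h = n) (hn : 0 < n) :
    IsTourOn (mateTour mate hR : Finset (Sym2 (HV n h s))) := by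
  refine isTourOn_cycEdges (nodup_tourSeq mate hR hmm hmi hn) (mem_tourSeq mate hR hmm hmi hn) ?_
  rw [length_tourSeq mate hR hmm hmi hn]
  have := card_reps_eq mate hmm hmi hhn
  omega

/-- **It lies inside the gadget.** [folklore] -/
theorem mateTour_subset (hR : (reps mate).card = h) (hmm : ∀ i, mate (mate i) = i)
    (hmi : ∀ i, mate i ≠ i) (hn : 0 < n) :
    ∀ e ∈ (mateTour mate hR : Finset (Sym2 (HV n h s))), e ∈ (hubGadget n h s).edgeSet :=
  cycEdges_subset_edgeSet (tourSeq_ne_nil mate hR hmm hmi hn) (isChain_tourSeq mate hR hmm hmi hn)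
    (adj_getLast_head_tourSeq mate hR hmm hmi hn)

/-- Every block is a contiguous piece of the sequence. [folklore] -/
theorem blk_infix (hR : (reps mate).card = h) (l : Fin h) :
    ∃ pre post, (tourSeq mate hR : List (HV n h s)) = pre ++ blk mate hR l ++ post := by
  obtain ⟨s₁, t₁, hst⟩ := List.append_of_mem (mem_toList.2 (mem_univ l))
  refine ⟨s₁.flatMap (blk mate hR), t₁.flatMap (blk mate hR), ?_⟩
  rw [tourSeq, hst, List.flatMap_append, List.flatMap_cons, List.append_assoc]

/-- The matched pairs are `v–v` edges of the tour. [folklore] -/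
theorem vv_mate_mem_mateTour (hR : (reps mate).card = h) (hmm : ∀ i, mate (mate i) = i)
    (hmi : ∀ i, mate i ≠ i) (i : Fin n) :
    s(v i, v (mate i)) ∈ (mateTour mate hR : Finset (Sym2 (HV n h s))) := by
  -- reduce to representatives
  suffices key : ∀ r ∈ reps mate, s(v r, v (mate r)) ∈ (mateTour mate hR : Finset (Sym2 (HV n h s))) by
    rcases mem_reps_or mate hmm hmi i with hi | hi
    · exact key i hi
    · have := key (mate i) hi
      rwa [hmm, Sym2.eq_swap] at this
  intro r hr
  set l := hubOf mate hR hmm hmi r with hl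
  have hrep : rep mate hR l = r := by rw [hl, rep_hubOf, repOf_of_mem mate hr]
  obtain ⟨pre, post, hseq⟩ := blk_infix mate hR l (s := s)
  rw [mateTour, hseq]
  unfold blk
  rw [hrep]
  have : pre ++ (hub l :: w r :: ((if ((r : Fin n) : ℕ) = 0 then padsFrom s le_rfl else []) ++
      [v r, v (mate r), w (mate r)])) ++ post =
      (pre ++ hub l :: w r :: (if ((r : Fin n) : ℕ) = 0 then padsFrom s le_rfl else [])) ++
        v r :: v (mate r) :: (w (mate r) :: post) := by
    simp [List.append_assoc]
  rw [this]
  exact mem_cycEdges_append _ _ _ _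

/-- **The `v–v` edges of the tour are exactly the matched pairs.** [folklore] -/
theorem vv_mem_mateTour_iff (hR : (reps mate).card = h) (hmm : ∀ i, mate (mate i) = i)
    (hmi : ∀ i, mate i ≠ i) (hhn : 2 * h = n) (hn : 0 < n) (i j : Fin n) :
    s(v i, v j) ∈ (mateTour mate hR : Finset (Sym2 (HV n h s))) ↔ j = mate i := by
  constructor
  · intro hij
    obtain ⟨j₀, -, huniq⟩ := existsUnique_vv hn (isTourOn_mateTour mate hR hmm hmi hhn hn)
      (mateTour_subset mate hR hmm hmi hn) hhn i
    rw [huniq j hij, huniq (mate i) (vv_mate_mem_mateTour mate hR hmm hmi i)]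
  · rintro rfl
    exact vv_mate_mem_mateTour mate hR hmm hmi i

end HubTour

/-- **Every perfect matching of `K_n` is the `v–v` trace of a tour of the gadget**: for a
fixed-point-free involution `mate` of `Fin n` (`n = 2h ≥ 1`) there is a tour of the complete
graph on `HV n h s`, using only gadget edges, whose `v–v` edges are exactly the pairs
`{v i, v (mate i)}`. [folklore] -/
theorem exists_tour_of_mate {n h s : ℕ} (hhn : 2 * h = n) (hn : 0 < n) (mate : Fin n → Fin n)
    (hmm : ∀ i, mate (mate i) = i) (hmi : ∀ i, mate i ≠ i) :
    ∃ T : Finset (Sym2 (HV n h s)), IsTourOn T ∧ (∀ e ∈ T, e ∈ (hubGadget n h s).edgeSet) ∧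
      ∀ i j, s(v i, v j) ∈ T ↔ j = mate i :=
  ⟨HubTour.mateTour mate (HubTour.card_reps_eq mate hmm hmi hhn),
    HubTour.isTourOn_mateTour mate _ hmm hmi hhn hn,
    HubTour.mateTour_subset mate _ hmm hmi hn, HubTour.vv_mem_mateTour_iff mate _ hmm hmi hhn hn⟩

end Literature.Barriers.PneNP
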